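import Summits.AtomisticToContinuum.Crystallization.Theses.PalmUnimodularRigidity
import Literature.Probability.Process.PointStationaryLaw
import Literature.MathematicalPhysics.StatisticalMechanics.RootEnergy

/-!
# Sketch — crux-ideate stmt-AtomisticToContinuum-9225 (MinimiserShells), round 2, ideator 4

First-lemma signatures for three crux idea cards (levers), typed over existing declarations:

* `IdeatorFour.DefectExchange`      — card `defect-exchange-two-resolutions` (Mecke exchange to
  an allocated point: E[f(root)] = E[1_{root receives} · Σ f(senders)]; PROVED below from the
  Mecke identity alone).
* `IdeatorFour.AnnulusMandate`, `IdeatorFour.SquareCapMandate` — card `octahedral-annulus-mandate`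
  (a.s. the octahedral annulus above the root's nearest-neighbour distance is occupied; robust form:
  the first shell is SQUARE-CAPPED — kit j007481 showed radial windows separate Barlow from TCP sites by
  only ≈ 6 %, the cap type (4 vs 3 shell contacts) robustly).
* `IdeatorFour.ForceBalanceAS`, `IdeatorFour.EquilibriumLocalisation` — card
  `equilibrium-liouville-localisation` (a.s. zero net force on the root; force-balanced
  configurations: a (1/100)-bad but (1/20)-good site lies within R of an awful site or inside an
  R-ball that is a common affine image of a Barlow-stacking ball, i.e. homogeneously strained).
* `IdeatorFour.goodShell_iff` — the crux's conclusion, folded (sanity: our `GoodShell (1/100)`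
  IS the conclusion of `PalmUnimodularRigidity.MinimiserShells`).
-/

noncomputable section

open MeasureTheory
open scoped ENNReal

namespace Summit.AtomisticToContinuum.Crystallization.Cruxes.MinimiserShells.IdeatorFour

open Literature.Probability.Process (IsPointStationaryLaw IsRootedHardCore)
open Literature.MathematicalPhysics.StatisticalMechanics (lennardJones rootEnergy
  PeriodicConfiguration)
open Literature.Geometry.DiscreteGeometry (ShellCloseTo fccKissingPattern hcpKissingPattern)

/-- Ambient space. -/
abbrev E3 := EuclideanSpace ℝ (Fin 3)

/-- `e* = ⨅` over periodic configurations of the LJ energy per particle. -/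
def eStar : ℝ := ⨅ Q : PeriodicConfiguration 3, Q.energyPerParticle lennardJones

/-- The crux's frame, folded: a minimising point-stationary `δ`-hard-core probability law. -/
def IsMinimisingLaw (δ : ℝ) (P : Measure (Measure E3)) : Prop :=
  IsProbabilityMeasure P ∧ (∀ᵐ μ ∂P, IsRootedHardCore δ μ) ∧ IsPointStationaryLaw P ∧
    ∫ μ, rootEnergy lennardJones μ ∂P ≤ eStar

/-- The root's shell set within radius `5a/4`. -/
def rootShellSet (μ : Measure E3) (a : ℝ) : Set E3 :=
  {y | μ {y} ≠ 0 ∧ y ≠ 0 ∧ ‖y‖ ≤ 5 / 4 * a}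

/-- `(η·a)`-good root shell at scale `a` (matched to the `a`-scaled FCC or HCP pattern). -/
def GoodShellAt (η : ℝ) (μ : Measure E3) (a : ℝ) : Prop :=
  ∃ T : Finset E3, (↑T : Set E3) = rootShellSet μ a ∧
    (ShellCloseTo (η * a) T (Finset.image (fun v : E3 => a • v) fccKissingPattern) ∨
      ShellCloseTo (η * a) T (Finset.image (fun v : E3 => a • v) hcpKissingPattern))

/-- Good root shell at tolerance `η` for some scale `a ∈ [9/10, 1]`; `η = 1/100` is the crux's
conclusion, `η = 1/20` the coarse ("not awful") level. -/
def GoodShell (η : ℝ) (μ : Measure E3) : Prop :=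
  ∃ a : ℝ, 9 / 10 ≤ a ∧ a ≤ 1 ∧ GoodShellAt η μ a

/-- Sanity: `GoodShell (1/100) μ` is literally the conclusion of the crux for `μ`. [folklore] -/
theorem goodShell_iff (μ : Measure E3) :
    GoodShell (1 / 100) μ ↔
      (∃ a : ℝ, 9 / 10 ≤ a ∧ a ≤ 1 ∧ ∃ T : Finset E3,
        (↑T : Set E3) = {y : E3 | μ {y} ≠ 0 ∧ y ≠ 0 ∧ ‖y‖ ≤ 5 / 4 * a} ∧
        (ShellCloseTo (a / 100) T (Finset.image (fun v : E3 => a • v) fccKissingPattern) ∨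
          ShellCloseTo (a / 100) T (Finset.image (fun v : E3 => a • v) hcpKissingPattern))) := by
  unfold GoodShell GoodShellAt rootShellSet
  have h : ∀ a : ℝ, (1 : ℝ) / 100 * a = a / 100 := fun a => by ring
  simp only [h]

/-- The crux, folded (used only to display that the cards aim at the route decl by name). -/
theorem minimiserShells_iff_folded :
    Summit.AtomisticToContinuum.Crystallization.Theses.PalmUnimodularRigidity.MinimiserShells ↔
      ∀ δ : ℝ, 0 < δ → ∀ P : Measure (Measure E3), IsProbabilityMeasure P →
        (∀ᵐ μ ∂P, IsRootedHardCore δ μ) → IsPointStationaryLaw P →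
        (∫ μ, rootEnergy lennardJones μ ∂P) ≤ eStar → ∀ᵐ μ ∂P, GoodShell (1 / 100) μ := by
  unfold Summit.AtomisticToContinuum.Crystallization.Theses.PalmUnimodularRigidity.MinimiserShells
    IsRootedHardCore IsPointStationaryLaw rootEnergy eStar
  simp only [goodShell_iff]

/-! ## Card A — `defect-exchange-two-resolutions`: the exchange identity -/

/-- **Defect exchange (Mecke form).** For a point-stationary law `P`, a measurable `f ≥ 0` and a
measurable *allocation* `τ` (the root sends its whole mass `f μ` to the configuration point
`τ μ`, an atom of mass `1`), the expectation of `f` at the root equals the expectation of the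
total mass RECEIVED by the root: the sum of `f (θ_y μ)` over the points `y` whose allocation,
seen from `y`, is the old root `-y`.  With `τ` = "nearest bad site" and `f = (h - e*)^±` this
re-roots the energy balance of a minimising law at a typical DEFECT. -/
def DefectExchange : Prop :=
  ∀ P : Measure (Measure E3), IsPointStationaryLaw P →
    ∀ f : Measure E3 → ℝ≥0∞, Measurable f →
    ∀ τ : Measure E3 → E3, Measurable τ → (∀ᵐ μ ∂P, μ {τ μ} = 1) →
      ∫⁻ μ, f μ ∂P =
        ∫⁻ μ, ∫⁻ y, Set.indicator {y' : E3 | τ (Measure.map (fun z => z - y') μ) = -y'}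
          (fun y' => f (Measure.map (fun z => z - y') μ)) y ∂μ ∂P

/-- `DefectExchange` holds: it is the Mecke identity applied to `g μ y := 1{τ μ = y} · f μ`.
[folklore] -/
theorem defectExchange_holds : DefectExchange := by
  intro P hP f hf τ hτ hatom
  -- the transport kernel: all of `f μ` goes to the point `τ μ`
  set g : Measure E3 → E3 → ℝ≥0∞ := fun μ y => Set.indicator {y' : E3 | τ μ = y'} (fun _ => f μ) y
    with hg_def
  have hg : Measurable (Function.uncurry g) := by
    have hset : MeasurableSet {p : Measure E3 × E3 | τ p.1 = p.2} :=
      measurableSet_eq_fun (hτ.comp measurable_fst) measurable_snd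
    have : Function.uncurry g = Set.indicator {p : Measure E3 × E3 | τ p.1 = p.2}
        (fun p => f p.1) := by
      funext p
      rcases p with ⟨μ, y⟩
      simp only [Function.uncurry_apply_pair, hg_def, Set.indicator_apply, Set.mem_setOf_eq]
    rw [this]
    exact (hf.comp measurable_fst).indicator hset
  have hmecke := hP g hg
  -- left side: ∫⁻ y, g μ y ∂μ = f μ * μ {τ μ} = f μ  (a.e.)
  have hleft : ∫⁻ μ, ∫⁻ y, g μ y ∂μ ∂P = ∫⁻ μ, f μ ∂P := by
    refine lintegral_congr_ae (hatom.mono fun μ hμ => ?_)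
    have hs : ({y' : E3 | τ μ = y'} : Set E3) = {τ μ} := by
      ext y'; simp [eq_comm]
    simp only [hg_def, hs]
    rw [lintegral_indicator (measurableSet_singleton _), setLIntegral_const, hμ, mul_one]
  -- right side is literally the received mass
  have hright : ∫⁻ μ, ∫⁻ y, g (Measure.map (fun z => z - y) μ) (-y) ∂μ ∂P =
      ∫⁻ μ, ∫⁻ y, Set.indicator {y' : E3 | τ (Measure.map (fun z => z - y') μ) = -y'}
          (fun y' => f (Measure.map (fun z => z - y') μ)) y ∂μ ∂P := by
    refine lintegral_congr (fun μ => lintegral_congr (fun y => ?_))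
    simp only [hg_def, Set.indicator_apply, Set.mem_setOf_eq]
  rw [← hleft, hmecke, hright]

/-! ## Card B — `octahedral-annulus-mandate` -/

/-- `a` is the nearest-neighbour distance of the root in the configuration `μ`. -/
def IsNNDist (μ : Measure E3) (a : ℝ) : Prop :=
  (∃ y : E3, μ {y} ≠ 0 ∧ y ≠ 0 ∧ ‖y‖ = a) ∧ ∀ y : E3, μ {y} ≠ 0 → y ≠ 0 → a ≤ ‖y‖

/-- The octahedral annulus `(53/50·a, 31/20·a)` of the root (FCC/HCP: six square-capping
neighbours at `√2·a ≈ 1.414 a`; icosahedral `Z12`: empty up to `1.589 a`). -/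
def octAnnulus (a : ℝ) : Set E3 := {y : E3 | 53 / 50 * a < ‖y‖ ∧ ‖y‖ < 31 / 20 * a}

/-- **Annulus mandate** (card B's a.s. partial-structure target, the COARSE order parameter):
for every minimising point-stationary hard-core law, almost surely the octahedral annulus above
the root's nearest-neighbour distance is occupied. -/
def AnnulusMandate : Prop :=
  ∀ δ : ℝ, 0 < δ → ∀ P : Measure (Measure E3), IsMinimisingLaw δ P →
    ∀ᵐ μ ∂P, ∃ a : ℝ, IsNNDist μ a ∧ μ (octAnnulus a) ≠ 0

/-- **Square-capped first shell** (the ROBUST, combinatorial form of the coarse order parameter, read off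
kit j007481: radial windows separate Barlow from TCP sites only by ≈ 6 %, the cap TYPE does robustly): some
configuration point `y` in the wide window `(23/20·a, 3/2·a)` has at least FOUR of the root's first-shell
points (`‖z‖ ≤ 21/20·a`) within `21/20·a` of it — it caps a SQUARE (octahedral interstice; FCC/HCP: six such
`y` at `√2·a`, each over 4), whereas second-shell points of tetrahedrally close-packed environments cap
TRIANGLES (3). `μ` is a counting measure, so `μ {…}` counts points. -/
def SquareCapped (μ : Measure E3) (a : ℝ) : Prop :=
  ∃ y : E3, μ {y} ≠ 0 ∧ 23 / 20 * a < ‖y‖ ∧ ‖y‖ < 3 / 2 * a ∧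
    4 ≤ μ {z : E3 | z ≠ 0 ∧ ‖z‖ ≤ 21 / 20 * a ∧ dist z y ≤ 21 / 20 * a}

/-- **Square-cap mandate** (card B's a.s. target in robust form): for every minimising point-stationary
hard-core law, almost surely the root's first shell is square-capped. -/
def SquareCapMandate : Prop :=
  ∀ δ : ℝ, 0 < δ → ∀ P : Measure (Measure E3), IsMinimisingLaw δ P →
    ∀ᵐ μ ∂P, ∃ a : ℝ, IsNNDist μ a ∧ SquareCapped μ a

/-- **Two-shell annulus certificate** (card B's first deterministic lemma, HYBRID form: one
bond-transfer `t` of range `53/50·a` plus a far-field slack `s`): there are `c > s ≥ 0` and a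
bounded measurable transfer `t` such that for every rooted `a`-hard-core configuration whose
octahedral annulus is EMPTY, the transferred root energy exceeds `e* + c`, while for every rooted
`a`-hard-core configuration it is at least `e* - s`.  (Expectation of the transfer term vanishes
under any point-stationary law by the Mecke identity, so `AnnulusMandate` follows once the law
is known to be a.s. `a`-hard-core at its own NN scale.) -/
def TwoShellAnnulusCertificate : Prop :=
  ∃ c s : ℝ, 0 ≤ s ∧ s < c ∧ ∃ t : Measure E3 → E3 → ℝ, Measurable (Function.uncurry t) ∧
    (∃ M : ℝ, ∀ μ y, |t μ y| ≤ M) ∧ (∀ μ y, 53 / 50 < ‖y‖ → t μ y = 0) ∧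
    ∀ μ : Measure E3, ∀ a : ℝ, 9 / 10 ≤ a → a ≤ 1 → IsRootedHardCore a μ → IsNNDist μ a →
      (eStar - s ≤ rootEnergy lennardJones μ +
          ∫ y, (t μ y - t (Measure.map (fun z => z - y) μ) (-y)) ∂μ) ∧
      (μ (octAnnulus a) = 0 →
        eStar + c ≤ rootEnergy lennardJones μ +
          ∫ y, (t μ y - t (Measure.map (fun z => z - y) μ) (-y)) ∂μ)

/-! ## Card C — `equilibrium-liouville-localisation` -/

/-- LJ pair force magnitude factor: `V'(r)/r` with `V = r⁻¹²/12 - r⁻⁶/6`, i.e.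
`(-r⁻¹³ + r⁻⁷)/r = -r⁻¹⁴ + r⁻⁸` (junk `0` at `r = 0`). -/
def ljForceFactor (r : ℝ) : ℝ := -(r⁻¹) ^ 14 + (r⁻¹) ^ 8

/-- **Force balance almost surely** (free first-variation identity for minimising laws:
equivariant bounded displacement fields are admissible competitors, `e_uni ≥ e*` makes the
minimiser critical, and localisation in the Mecke identity gives a POINTWISE a.s. statement):
the net LJ force on the root vanishes. -/
def ForceBalanceAS : Prop :=
  ∀ δ : ℝ, 0 < δ → ∀ P : Measure (Measure E3), IsMinimisingLaw δ P →
    Summit.AtomisticToContinuum.Crystallization.Theses.PalmUnimodularRigidity.UnimodularEnergyLowerBound →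
    ∀ᵐ μ ∂P, ∫ y, (ljForceFactor ‖y‖) • y ∂μ = (0 : E3)

/-- Every point of the set `S` is force-balanced (deterministic equilibrium configuration). -/
def IsEquilibriumSet (S : Set E3) : Prop :=
  ∀ x ∈ S, HasSum (fun y : S => (ljForceFactor ‖(y : E3) - x‖) • ((y : E3) - x)) (0 : E3)

/-- Shell predicate at a point `x` of a set `S` (re-rooted copy of `GoodShell`). -/
def GoodShellIn (η : ℝ) (S : Set E3) (x : E3) : Prop :=
  GoodShell η ((Measure.count : Measure E3).restrict ((fun y => y - x) '' S))

/-- **Equilibrium localisation** (card C's deterministic first lemma; discrete elastostatic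
Caccioppoli/Liouville content): in a force-balanced `r₀`-hard-core configuration, a site whose
shell is `(1/20)`-good but `(1/100)`-bad either has an AWFUL (`(1/20)`-bad) site within distance
`R`, or its `R`-ball is a common affine image of a ball of SOME Barlow stacking (any Hägg word: a
defect-free ball may contain stacking faults) up to `1/200` per site — homogeneous strain, self-priced
at the measure level by zero-pressure convexity `e(A·L) ≥ e*`. -/
def EquilibriumLocalisation : Prop :=
  ∃ R : ℝ, 0 < R ∧ ∀ r₀ : ℝ, 17 / 20 ≤ r₀ →
    ∀ S : Set E3, (∀ x ∈ S, ∀ y ∈ S, x ≠ y → r₀ ≤ dist x y) → IsEquilibriumSet S →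
      ∀ x ∈ S, GoodShellIn (1 / 20) S x → ¬ GoodShellIn (1 / 100) S x →
        (∃ z ∈ S, dist z x ≤ R ∧ ¬ GoodShellIn (1 / 20) S z) ∨
        (∃ A : E3 →L[ℝ] E3, ∃ s : ℤ → ℤ,
          Literature.MathematicalPhysics.StatisticalMechanics.IsHaggSeq s ∧
          ∀ y ∈ S, dist y x ≤ R →
            ∃ p ∈ Literature.MathematicalPhysics.StatisticalMechanics.barlowStacking 1
              (Real.sqrt (2 / 3)) s, dist (y - x) (A p) ≤ 1 / 200)

end Summit.AtomisticToContinuum.Crystallization.Cruxes.MinimiserShells.IdeatorFour
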